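import Summits.ValiantsHypothesis.ValiantsHypothesis.Theses.PrincipalMinorColouring
import Literature.Computability.AlgebraicComplexity.PochhammerWilkinsonCHProofs
import Literature.Computability.Complexity.CircuitClasses
import Literature.Computability.Complexity.ProbabilisticClasses

/-!
# Birth skeleton — piece A `ConstantFreePerNotQP` of the constants-seam split of `TotalRankNotQP`
(crux stmt-ValiantsHypothesis-3775, route PrincipalMinorColouring)

Piece A (constant-free Extended Valiant Hypothesis, multiplier-tolerant): for every sequence of
nonzero integers `N_n`, `n ↦ τ(N_n · PER_n)` is not quasi-polynomially bounded.

Two independent stub lines, each concluding A BY NAME with a real composition proof: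

* LINE 1 (Boolean, GRH-free because constant-free): `stub_ppQPSize` (Bürgisser 2009 Lemma 2.12
  at qp scale with a multiplier: a sign-constant circuit of qp size for `N_n · PER_n`, evaluated
  modulo an advice prime `p ∤ N_n`, `p > n!`, of qp bit-size, puts `PP` in qp-SIZE; size L,
  provable by re-running `PP_subset_PPoly_of_isPBounded_perPoly_holds`) and `stub_ppNotQPSize`
  (the Boolean bet `PP ⊄ SIZE(2^{polylog})`).
* LINE 2 (Diophantine): `stub_shubSmaleTau` (= item stmt-ValiantsHypothesis-0336
  `TauConst.TauConjecture`, verbatim `ShubSmaleTauConjecture`) and `stub_thm41_2_QP` (Bürgisser's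
  Thm. 4.1(2) at qp scale with multipliers: CH-definable coefficient sequences give polynomials
  `M_n · f_n`, `M_n ≠ 0`, with `τ ≤ 2^((log₂ log₂ n + c)^c)`; size L, by re-running
  `Burgisser2009_thm41_2_uniform_holds` with `CH ⊆ qp-SIZE`), composed through the GENUINE endgame
  `ConstantFreePerNotQP_of'` (Pochhammer–Wilkinson root count against the τ-conjecture, with the
  new growth lemma `exists_loglog_qp_lt`).
-/

set_option linter.dupNamespace false

namespace Summit.ValiantsHypothesis.ValiantsHypothesis.Cruxes.TotalRankNotQP.ConstantsSeam

open Literature.Computability.AlgebraicComplexity Literature.Computability.Complexity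

/-- Piece A, verbatim the child statement `PrincipalMinorColouring.ConstantFreePerNotQP`. -/
def ConstantFreePerNotQP : Prop :=
  ∀ N : ℕ → ℤ, (∀ n, N n ≠ 0) → ¬ Literature.Computability.AlgebraicComplexity.IsQPBounded (fun n => Literature.Computability.AlgebraicComplexity.constantFreeComplexity (MvPolynomial.C (N n) * Literature.Computability.AlgebraicComplexity.perPoly (Fin n) ℤ))

/-! ## LINE 1 — Boolean transfer -/

/-- stub (L, provable-now by re-running Bürgisser 2009 Lemma 2.12 = tree
`PP_subset_PPoly_of_isPBounded_perPoly_holds` at quasi-polynomial scale, inverting the multiplier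
`N_n` modulo an advice prime): qp-size sign-constant circuits for `N_n · PER_n` put `PP` into
quasi-polynomial SIZE. -/
theorem stub_ppQPSize :
    ∀ N : ℕ → ℤ, (∀ n, N n ≠ 0) →
      IsQPBounded (fun n => constantFreeComplexity (MvPolynomial.C (N n) * perPoly (Fin n) ℤ)) →
        ∃ c : ℕ, PP ⊆ SIZE (fun n => 2 ^ ((Nat.log 2 n + c) ^ c)) := by
  sorry

/-- stub (the Boolean bet; standard, unproved): `PP` has no quasi-polynomial-size circuits. -/
theorem stub_ppNotQPSize : ∀ c : ℕ, ¬ (PP ⊆ SIZE (fun n => 2 ^ ((Nat.log 2 n + c) ^ c))) := by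
  sorry

/-- LINE 1 composition: A from the two Boolean stubs. -/
theorem ConstantFreePerNotQP_of
    (h₁ : ∀ N : ℕ → ℤ, (∀ n, N n ≠ 0) →
      IsQPBounded (fun n => constantFreeComplexity (MvPolynomial.C (N n) * perPoly (Fin n) ℤ)) →
        ∃ c : ℕ, PP ⊆ SIZE (fun n => 2 ^ ((Nat.log 2 n + c) ^ c)))
    (h₂ : ∀ c : ℕ, ¬ (PP ⊆ SIZE (fun n => 2 ^ ((Nat.log 2 n + c) ^ c)))) :
    ConstantFreePerNotQP := by
  intro N hN hqp
  obtain ⟨c, hc⟩ := h₁ N hN hqp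
  exact h₂ c hc

/-! ## LINE 2 — Shub–Smale τ-conjecture + Bürgisser's transfer at quasi-polynomial scale -/

/-- stub (the Diophantine bet = item stmt-ValiantsHypothesis-0336 `TauConst.TauConjecture`,
verbatim the tree's `ShubSmaleTauConjecture`). -/
theorem stub_shubSmaleTau : ShubSmaleTauConjecture := by
  sorry

/-- stub (L, provable-now by re-running the tree's `Burgisser2009_thm41_2_uniform_holds` with
`CH ⊆ SIZE(2^polylog)` in place of `CH ⊆ P/poly` and the multiplier carried through Valiant's
criterion): **Bürgisser's Thm. 4.1(2) at quasi-polynomial scale** — if `τ(N_n · PER_n)` is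
qp-bounded for some nonzero multipliers, every `CH`-definable coefficient sequence `b(n,k)`,
`k ≤ q(n)`, gives polynomials `M_n · ∑_k b(n,k) X^k`, `M_n ≠ 0`, of constant-free complexity
`≤ 2^((log₂ log₂ n + c)^c)`. -/
theorem stub_thm41_2_QP :
    ∀ N : ℕ → ℤ, (∀ n, N n ≠ 0) →
      IsQPBounded (fun n => constantFreeComplexity (MvPolynomial.C (N n) * perPoly (Fin n) ℤ)) →
        ∀ (q : ℕ → ℕ) (b : ℕ → ℕ → ℤ), IsCHDefinable q b →
          ∃ (M : ℕ → ℤ) (c : ℕ), (∀ n, M n ≠ 0) ∧ ∀ n,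
            tauPoly (Polynomial.C (M n) *
              ∑ k ∈ Finset.range (q n + 1), Polynomial.C (b n k) * Polynomial.X ^ k) ≤
              2 ^ ((Nat.log 2 (Nat.log 2 n) + c) ^ c) := by
  sorry

/-- Growth lemma for the endgame: `(2^((log₂ log₂ n + c)^c) + 2)^{c₀} < n` for some `n`
(take `n = 2^(2^M)` with `(M)^d < 2^(M-2)`, `d = c + 2 c₀ (c+1)^c`). [folklore] -/
theorem exists_loglog_qp_lt (c c₀ : ℕ) :
    ∃ n : ℕ, (2 ^ ((Nat.log 2 (Nat.log 2 n) + c) ^ c) + 2) ^ c₀ < n := by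
  obtain ⟨m, hm1, hm⟩ := exists_add_two_pow_lt_two_pow (c + 2 * c₀ * (c + 1) ^ c)
  refine ⟨2 ^ (2 ^ (m + 2)), ?_⟩
  rw [Nat.log_pow (by norm_num), Nat.log_pow (by norm_num)]
  set M := m + 2 with hM
  have hM3 : 3 ≤ M := by omega
  have hE1 : 1 ≤ (M + c) ^ c := Nat.one_le_pow _ _ (by omega)
  have h2E : 2 ≤ 2 ^ ((M + c) ^ c) := by
    calc (2 : ℕ) = 2 ^ 1 := rfl
      _ ≤ 2 ^ ((M + c) ^ c) := Nat.pow_le_pow_right (by norm_num) hE1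
  have hx : 2 ^ ((M + c) ^ c) + 2 ≤ 2 ^ ((M + c) ^ c + 1) := by
    rw [pow_succ]
    linarith
  have step1 : (2 ^ ((M + c) ^ c) + 2) ^ c₀ ≤ 2 ^ (c₀ * ((M + c) ^ c + 1)) := by
    calc (2 ^ ((M + c) ^ c) + 2) ^ c₀ ≤ (2 ^ ((M + c) ^ c + 1)) ^ c₀ := Nat.pow_le_pow_left hx _
      _ = 2 ^ (((M + c) ^ c + 1) * c₀) := by rw [← pow_mul]
      _ = 2 ^ (c₀ * ((M + c) ^ c + 1)) := by rw [mul_comm]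
  have hexp : c₀ * ((M + c) ^ c + 1) < 2 ^ M := by
    have h1 : M + c ≤ M * (c + 1) := by nlinarith
    have h2 : (M + c) ^ c ≤ M ^ c * (c + 1) ^ c := by
      rw [← mul_pow]
      exact Nat.pow_le_pow_left h1 c
    have h4 : c₀ * ((M + c) ^ c + 1) ≤ 2 * c₀ * (c + 1) ^ c * M ^ c := by
      calc c₀ * ((M + c) ^ c + 1) ≤ c₀ * ((M + c) ^ c + (M + c) ^ c) :=
            Nat.mul_le_mul_left _ (Nat.add_le_add_left hE1 _)
        _ = 2 * c₀ * (M + c) ^ c := by ring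
        _ ≤ 2 * c₀ * (M ^ c * (c + 1) ^ c) := Nat.mul_le_mul_left _ h2
        _ = 2 * c₀ * (c + 1) ^ c * M ^ c := by ring
    have h5 : 2 * c₀ * (c + 1) ^ c ≤ M ^ (2 * c₀ * (c + 1) ^ c) := by
      calc 2 * c₀ * (c + 1) ^ c ≤ 3 ^ (2 * c₀ * (c + 1) ^ c) := (Nat.lt_pow_self (by norm_num)).le
        _ ≤ M ^ (2 * c₀ * (c + 1) ^ c) := Nat.pow_le_pow_left hM3 _
    calc c₀ * ((M + c) ^ c + 1) ≤ 2 * c₀ * (c + 1) ^ c * M ^ c := h4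
      _ ≤ M ^ (2 * c₀ * (c + 1) ^ c) * M ^ c := Nat.mul_le_mul_right _ h5
      _ = M ^ (c + 2 * c₀ * (c + 1) ^ c) := by rw [← pow_add, add_comm]
      _ < 2 ^ m := hm
      _ ≤ 2 ^ M := Nat.pow_le_pow_right (by norm_num) (by omega)
  calc (2 ^ ((M + c) ^ c) + 2) ^ c₀ ≤ 2 ^ (c₀ * ((M + c) ^ c + 1)) := step1
    _ < 2 ^ 2 ^ M := Nat.pow_lt_pow_right (by norm_num) hexp

/-- LINE 2 composition (a genuine endgame, the qp analogue of the tree's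
`not_isPBounded_constantFreeComplexity_perPoly_of_tauConjecture_of`): the Pochhammer–Wilkinson
polynomials `f_n = ∏_{k ≤ n} (X - k)` have `CH`-definable coefficients
(`Burgisser2009_pochhammerWilkinson_coeff_chDefinable_holds`, PROVED in the tree), so under the
qp-boundedness of some `τ(N_n · PER_n)` the stub gives `τ(M_n f_n) ≤ 2^((log₂ log₂ n + c)^c)`;
`M_n f_n ≠ 0` has the `n` integer roots `1, …, n`, and the τ-conjecture bounds `n` by
`(2^((log₂ log₂ n + c)^c) + 2)^{c₀}`, which fails for `n = 2^(2^M)` large. -/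
theorem ConstantFreePerNotQP_of'
    (hτ : ShubSmaleTauConjecture)
    (h41 : ∀ N : ℕ → ℤ, (∀ n, N n ≠ 0) →
      IsQPBounded (fun n => constantFreeComplexity (MvPolynomial.C (N n) * perPoly (Fin n) ℤ)) →
        ∀ (q : ℕ → ℕ) (b : ℕ → ℕ → ℤ), IsCHDefinable q b →
          ∃ (M : ℕ → ℤ) (c : ℕ), (∀ n, M n ≠ 0) ∧ ∀ n,
            tauPoly (Polynomial.C (M n) *
              ∑ k ∈ Finset.range (q n + 1), Polynomial.C (b n k) * Polynomial.X ^ k) ≤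
              2 ^ ((Nat.log 2 (Nat.log 2 n) + c) ^ c)) :
    ConstantFreePerNotQP := by
  intro N hN hqp
  obtain ⟨c₀, hc₀⟩ := hτ
  obtain ⟨M, c, hM, hc⟩ := h41 N hN hqp (fun n => n) (fun n k => (pochhammerWilkinson n).coeff k)
    Burgisser2009_pochhammerWilkinson_coeff_chDefinable_holds
  -- the polynomials `g n = M n • f_n`
  set g : ℕ → Polynomial ℤ := fun n => Polynomial.C (M n) * pochhammerWilkinson n with hg
  have hg_ne : ∀ n, g n ≠ 0 := fun n =>
    mul_ne_zero (Polynomial.C_ne_zero.2 (hM n)) (pochhammerWilkinson_ne_zero n)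
  have hτg : ∀ n, tauPoly (g n) ≤ 2 ^ ((Nat.log 2 (Nat.log 2 n) + c) ^ c) := fun n => by
    simpa only [hg, sum_range_coeff_pochhammerWilkinson] using hc n
  -- `g n` has at least `n` distinct integer roots
  have hroots : ∀ n, n ≤ (g n).roots.toFinset.card := fun n => by
    have hle : (pochhammerWilkinson n).roots ≤ (g n).roots :=
      Polynomial.roots.le_of_dvd (hg_ne n) (dvd_mul_left _ _)
    calc n = (pochhammerWilkinson n).roots.toFinset.card :=
          (card_roots_toFinset_pochhammerWilkinson n).symm
      _ ≤ (g n).roots.toFinset.card :=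
          Finset.card_le_card (Multiset.toFinset_subset.2 (Multiset.subset_of_le hle))
  -- the τ-conjecture bound, contradicted by the growth lemma
  have key : ∀ n, n ≤ (2 ^ ((Nat.log 2 (Nat.log 2 n) + c) ^ c) + 2) ^ c₀ := fun n =>
    calc n ≤ (g n).roots.toFinset.card := hroots n
      _ ≤ (tauPoly (g n) + 2) ^ c₀ := hc₀ (g n) (hg_ne n)
      _ ≤ (2 ^ ((Nat.log 2 (Nat.log 2 n) + c) ^ c) + 2) ^ c₀ :=
          Nat.pow_le_pow_left (Nat.add_le_add_right (hτg n) 2) _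
  obtain ⟨n, hn⟩ := exists_loglog_qp_lt c c₀
  exact absurd (key n) (not_le.2 hn)

end Summit.ValiantsHypothesis.ValiantsHypothesis.Cruxes.TotalRankNotQP.ConstantsSeam
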